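import Mathlib
import Summits.MatrixMultiplication.Statement
import Literature.RingTheory.KrullDimension.AffineCatenary

/-!
# Graph equations — the RULED-JOIN THEOREM: isotropic vectors from a polynomial kernel field (M65)

Continuation of M64 (`GraphEquationsPointwisePurification`), which reduced
`CubicEquationsForceMultiplication` (`[ω₃ = ω]`) to the ISOTROPIC KERNEL LEMMA
`IsotropicKernelLemma d`.  This file proves the ALGEBRAIC HEART of that lemma, in coordinates and
without any intersection theory, by Fulton's *ruled join* (Intersection Theory, Ex. 8.4.5): a
bi-homogeneous correspondence `Z ⊂ ℙ^{d-1} × ℙ^{d-1}` meets the diagonal as soon as the affine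
bi-cone `Ẑ ⊂ ℂ^d × ℂ^d = ℂ^{2d}` has an irreducible component of dimension `≥ d + 1`, because the
diagonal of `ℂ^{2d}` is cut out by only `d` linear forms and misses the two coordinate axes-blocks
`{x = 0}`, `{y = 0}` away from the origin.

**THEOREM `exists_isotropic_of_polyKernel`.**  Let `M₁, …, M_m` be `d × d` complex matrices
(bilinear forms `bᵢ(x,y) = xᵀ Mᵢ y`) and let `F = (F₁, …, F_d)` be a NONZERO vector of polynomials
in `x = (x₁, …, x_d)` which is a kernel field: `bᵢ(x, F(x)) ≡ 0` for all `i` (as polynomial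
identities).  Then some `x ≠ 0` is isotropic: `bᵢ(x,x) = 0` for all `i`.

**Proof (formalised below).**  Let `R = ℂ[x,y]`, `S = ℂ[x,t]` and `φ : R → S`, `x ↦ x`,
`y_q ↦ t·F_q(x)`; `P = ker φ` is prime, contains the bilinear polynomials `bᵢ(x,y)` (since
`bᵢ(x, tF(x)) = t·bᵢ(x,F(x)) = 0`) and lies in the origin ideal `m₀`.  In `R̄ = R/P` the chain of
primes `0 ⊊ φ⁻¹(t) ⊊ φ⁻¹(t,x₁) ⊊ ⋯ ⊊ φ⁻¹(t,x₁,…,x_d) = m̄₀` (strictness witnessed by `y_{q₀}` with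
`F_{q₀} ≠ 0`, then by `x₁, …, x_d`) gives `height m̄₀ ≥ d + 1`, while by KRULL'S HEIGHT THEOREM a
minimal prime `Q̄ ⊆ m̄₀` of the diagonal ideal `(ȳ_q - x̄_q : q)` (only `d` generators) has height
`≤ d`; so `Q̄ ≠ m̄₀`, and by the NULLSTELLENSATZ the prime `Q = mk⁻¹(Q̄) ⊋ P + (y - x)`, `Q ⊊ m₀`, has a
zero `(x,y) ≠ 0`; there `y = x`, hence `x ≠ 0` and `bᵢ(x,x) = 0`.

The remaining (linear-algebra) step of the isotropic kernel lemma — producing the polynomial kernel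
field `F` from the pointwise hypothesis by Cramer vectors of a maximal non-vanishing minor — and the
transfer to abstract spaces are carried out in the sequel (M66).

## Main statements

* `bilinRowPoly`, `dotProduct_mulVec_eq_sum` (coordinates of `xᵀ M y`).
* `killBelow d j` (the substitution `t, x_i ↦ 0 (i < j)`), `killBelow_comp`, `ker_killBelow_mono`,
  `killBelow_top`.
* **`exists_isotropic_of_polyKernel`** (the ruled-join theorem).
-/

set_option linter.dupNamespace false

namespace Summit.MatrixMultiplication.MatrixMultiplication.Theorems.GraphEquations

open MvPolynomial Matrix

section Join

variable {d m : ℕ}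

/-- The row polynomial `T_{i,k}(x) = Σ_j x_j M_{i,j,k}`, the `k`-th coefficient of the linear form
`y ↦ xᵀ Mᵢ y`. -/
noncomputable def bilinRowPoly (M : Fin m → Matrix (Fin d) (Fin d) ℂ) (i : Fin m) (k : Fin d) :
    MvPolynomial (Fin d) ℂ :=
  ∑ j, X j * C (M i j k)

/-- `xᵀ N y = Σ_k (Σ_j x_j N_{j,k}) y_k`. -/
theorem dotProduct_mulVec_eq_sum (N : Matrix (Fin d) (Fin d) ℂ) (x y : Fin d → ℂ) :
    x ⬝ᵥ (N *ᵥ y) = ∑ k, (∑ j, x j * N j k) * y k := by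
  simp only [dotProduct, mulVec, Finset.mul_sum, Finset.sum_mul]
  rw [Finset.sum_comm]
  refine Finset.sum_congr rfl fun k _ => Finset.sum_congr rfl fun j _ => ?_
  ring

/-- Evaluating the row polynomial. -/
theorem eval_bilinRowPoly (M : Fin m → Matrix (Fin d) (Fin d) ℂ) (i : Fin m) (k : Fin d)
    (x : Fin d → ℂ) : eval x (bilinRowPoly M i k) = ∑ j, x j * M i j k := by
  simp [bilinRowPoly, map_sum, eval_X, eval_C]

/-- The substitution homomorphism of `ℂ[x₁,…,x_d,t]` killing `t` and the variables `x_i` with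
`i < j`, fixing the other variables. -/
noncomputable def killBelow (d j : ℕ) :
    MvPolynomial (Fin d ⊕ Unit) ℂ →+* MvPolynomial (Fin d ⊕ Unit) ℂ :=
  eval₂Hom C (Sum.elim (fun i : Fin d => if (i : ℕ) < j then 0 else X (Sum.inl i)) fun _ => 0)

/-- `killBelow` on an `x`-variable. -/
theorem killBelow_X_inl (j : ℕ) (i : Fin d) :
    killBelow d j (X (Sum.inl i)) = if (i : ℕ) < j then 0 else X (Sum.inl i) := by
  simp [killBelow]

/-- `killBelow` kills `t`. -/
theorem killBelow_X_inr (j : ℕ) (u : Unit) :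
    killBelow d j (X (Sum.inr u) : MvPolynomial (Fin d ⊕ Unit) ℂ) = 0 := by
  simp [killBelow]

/-- `killBelow` fixes constants. -/
theorem killBelow_C (j : ℕ) (c : ℂ) :
    killBelow d j (C c : MvPolynomial (Fin d ⊕ Unit) ℂ) = C c := by
  simp [killBelow]

/-- Killing more variables after fewer is killing more. -/
theorem killBelow_comp {j k : ℕ} (hjk : j ≤ k) :
    (killBelow d k).comp (killBelow d j) = killBelow d k := by
  refine ringHom_ext (fun c => by simp [killBelow_C]) fun v => ?_
  rcases v with i | u
  · by_cases h : (i : ℕ) < j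
    · have hk : (i : ℕ) < k := lt_of_lt_of_le h hjk
      simp [killBelow_X_inl, h, hk]
    · simp [killBelow_X_inl, h]
  · simp [killBelow_X_inr]

/-- The kernels of the substitutions increase with `j`. -/
theorem ker_killBelow_mono {j k : ℕ} (hjk : j ≤ k) :
    RingHom.ker (killBelow d j) ≤ RingHom.ker (killBelow d k) := by
  intro g hg
  rw [RingHom.mem_ker] at hg ⊢
  have := DFunLike.congr_fun (killBelow_comp (d := d) hjk) g
  rw [RingHom.comp_apply, hg, map_zero] at this
  exact this.symm

/-- Killing every variable is the constant coefficient. -/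
theorem killBelow_top (g : MvPolynomial (Fin d ⊕ Unit) ℂ) :
    killBelow d d g = C (constantCoeff g) := by
  have h : (Sum.elim (fun i : Fin d => if (i : ℕ) < d then (0 : MvPolynomial (Fin d ⊕ Unit) ℂ)
      else X (Sum.inl i)) fun _ : Unit => (0 : MvPolynomial (Fin d ⊕ Unit) ℂ)) =
      fun _ : Fin d ⊕ Unit => (0 : MvPolynomial (Fin d ⊕ Unit) ℂ) := by
    funext v
    rcases v with i | u
    · simp
    · simp
  unfold killBelow
  rw [h, eval₂Hom_zero'_apply]

set_option maxHeartbeats 800000 in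
/-- **The ruled-join theorem** (algebraic heart of the isotropic kernel lemma).  If a nonzero
polynomial vector `F(x)` satisfies `xᵀ Mᵢ F(x) ≡ 0` for every `i`, then some `x ≠ 0` satisfies
`xᵀ Mᵢ x = 0` for every `i`.  Proof: Krull's height theorem in `ℂ[x,y]/ker(y ↦ tF(x))` against an
explicit chain of `d + 2` primes, then Hilbert's Nullstellensatz (see the module docstring). -/
theorem exists_isotropic_of_polyKernel (M : Fin m → Matrix (Fin d) (Fin d) ℂ)
    (F : Fin d → MvPolynomial (Fin d) ℂ) (q₀ : Fin d) (hF : F q₀ ≠ 0)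
    (hTF : ∀ i, ∑ k, bilinRowPoly M i k * F k = 0) :
    ∃ x : Fin d → ℂ, x ≠ 0 ∧ ∀ i, x ⬝ᵥ (M i *ᵥ x) = 0 := by
  classical
  let σ := Fin d ⊕ Fin d
  let τ := Fin d ⊕ Unit
  -- the parametrisation `x ↦ x`, `y_q ↦ t · F_q(x)`
  let φ : MvPolynomial σ ℂ →+* MvPolynomial τ ℂ :=
    eval₂Hom C (Sum.elim (fun j => X (Sum.inl j)) fun q => X (Sum.inr ()) * rename Sum.inl (F q))
  have hφl : ∀ j, φ (X (Sum.inl j)) = X (Sum.inl j) := fun j => by simp [φ]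
  have hφr : ∀ q, φ (X (Sum.inr q)) = X (Sum.inr ()) * rename Sum.inl (F q) := fun q => by
    simp [φ]
  have hφC : ∀ c, φ (C c) = C c := fun c => by simp [φ]
  -- the bilinear polynomials `bᵢ(x,y)` and the diagonal forms `y_q - x_q`
  let Bp : Fin m → MvPolynomial σ ℂ := fun i =>
    ∑ j, ∑ k, X (Sum.inl j) * C (M i j k) * X (Sum.inr k)
  let Lp : Fin d → MvPolynomial σ ℂ := fun q => X (Sum.inr q) - X (Sum.inl q)
  -- `P = ker φ` is prime and contains the `bᵢ`
  let P : Ideal (MvPolynomial σ ℂ) := RingHom.ker φ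
  haveI hPprime : P.IsPrime := RingHom.ker_isPrime φ
  have hBP : ∀ i, Bp i ∈ P := by
    intro i
    rw [RingHom.mem_ker]
    have h1 : φ (Bp i) = X (Sum.inr ()) * rename Sum.inl (∑ k, bilinRowPoly M i k * F k) := by
      simp only [Bp, bilinRowPoly, map_sum, map_mul, hφl, hφr, hφC, rename_X, rename_C, Finset.mul_sum,
        Finset.sum_mul]
      rw [Finset.sum_comm]
      refine Finset.sum_congr rfl fun k _ => Finset.sum_congr rfl fun j _ => ?_
      ring
    rw [h1, hTF i, map_zero, mul_zero]
  -- `φ` preserves constant coefficients, so `P ⊆ m₀`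
  have hcc : ∀ g, constantCoeff (φ g) = constantCoeff g := by
    have h : (constantCoeff : MvPolynomial τ ℂ →+* ℂ).comp φ = constantCoeff := by
      refine ringHom_ext (fun c => by simp [hφC]) fun v => ?_
      rcases v with j | q
      · simp [hφl]
      · simp [hφr, constantCoeff_X]
    exact fun g => DFunLike.congr_fun h g
  let m₀ : Ideal (MvPolynomial σ ℂ) := RingHom.ker (constantCoeff : MvPolynomial σ ℂ →+* ℂ)
  haveI hmax : m₀.IsMaximal :=
    RingHom.ker_isMaximal_of_surjective _ fun c => ⟨C c, constantCoeff_C _ c⟩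
  have hPm : P ≤ m₀ := fun g hg => by
    rw [RingHom.mem_ker] at hg ⊢
    rw [← hcc g, hg, map_zero]
  -- the quotient ring `R̄ = ℂ[x,y]/P`
  let mk := Ideal.Quotient.mk P
  have hmk : Function.Surjective mk := Ideal.Quotient.mk_surjective
  have hker : RingHom.ker mk = P := Ideal.mk_ker
  have hback : ∀ {I : Ideal (MvPolynomial σ ℂ)}, P ≤ I → ∀ {g}, mk g ∈ I.map mk → g ∈ I := by
    intro I hPI g hg
    have h1 : g ∈ (I.map mk).comap mk := Ideal.mem_comap.mpr hg
    rw [Ideal.comap_map_of_surjective mk hmk, ← RingHom.ker_eq_comap_bot, hker,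
      sup_eq_left.mpr hPI] at h1
    exact h1
  have hmapPrime : ∀ {I : Ideal (MvPolynomial σ ℂ)}, I.IsPrime → P ≤ I → (I.map mk).IsPrime :=
    fun hI hPI => Ideal.map_isPrime_of_surjective hmk (by rwa [hker])
  have hmap_lt : ∀ {I J : Ideal (MvPolynomial σ ℂ)}, P ≤ I → I ≤ J →
      ∀ g, g ∈ J → g ∉ I → I.map mk < J.map mk := by
    intro I J hPI hIJ g hgJ hgI
    refine lt_of_le_of_ne (Ideal.map_mono hIJ) fun h => hgI ?_
    exact hback hPI (h ▸ Ideal.mem_map_of_mem mk hgJ)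
  -- the image `M₀` of the origin and the diagonal ideal; Krull's height theorem
  let M₀ : Ideal (MvPolynomial σ ℂ ⧸ P) := m₀.map mk
  haveI hM₀ : M₀.IsPrime := hmapPrime hmax.isPrime hPm
  let s : Finset (MvPolynomial σ ℂ ⧸ P) := Finset.univ.image fun q => mk (Lp q)
  have hsM : Ideal.span (s : Set (MvPolynomial σ ℂ ⧸ P)) ≤ M₀ := by
    refine Ideal.span_le.2 fun z hz => ?_
    obtain ⟨q, -, rfl⟩ := Finset.mem_image.1 (Finset.mem_coe.1 hz)
    refine Ideal.mem_map_of_mem _ ?_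
    simp [m₀, Lp, RingHom.mem_ker, constantCoeff_X]
  obtain ⟨Qb, hQb, hQbM⟩ := Ideal.exists_minimalPrimes_le hsM
  haveI hQbprime : Qb.IsPrime := hQb.1.1
  have hQbh : Qb.height ≤ d := by
    refine (Ideal.height_le_card_of_mem_minimalPrimes_span_finset hQb).trans ?_
    exact_mod_cast Finset.card_image_le.trans (by simp)
  -- the chain of primes `q_j = φ⁻¹(ker killBelow j)`, `j = 0, …, d`
  let q : ℕ → Ideal (MvPolynomial σ ℂ) := fun j => (RingHom.ker (killBelow d j)).comap φ
  have hqprime : ∀ j, (q j).IsPrime := fun j =>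
    haveI : (RingHom.ker (killBelow d j)).IsPrime := RingHom.ker_isPrime _
    Ideal.comap_isPrime φ _
  have hPq : ∀ j, P ≤ q j := fun j g hg => by
    rw [RingHom.mem_ker] at hg
    simp [q, Ideal.mem_comap, hg]
  have hqmono : ∀ j k, j ≤ k → q j ≤ q k := fun j k hjk =>
    Ideal.comap_mono (ker_killBelow_mono hjk)
  have hx_in : ∀ j (hj : j < d), X (Sum.inl ⟨j, hj⟩) ∈ q (j + 1) := by
    intro j hj
    simp [q, Ideal.mem_comap, RingHom.mem_ker, hφl, killBelow_X_inl]
  have hx_out : ∀ j (hj : j < d), X (Sum.inl ⟨j, hj⟩) ∉ q j := by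
    intro j hj
    simp [q, Ideal.mem_comap, RingHom.mem_ker, hφl, killBelow_X_inl, X_ne_zero]
  have hy_in : X (Sum.inr q₀) ∈ q 0 := by
    simp [q, Ideal.mem_comap, RingHom.mem_ker, hφr, killBelow_X_inr]
  have hy_out : X (Sum.inr q₀) ∉ P := by
    rw [RingHom.mem_ker, hφr]
    refine mul_ne_zero (X_ne_zero _) fun h => hF ?_
    exact rename_injective _ Sum.inl_injective (by rw [h, map_zero])
  have hq_top : q d ≤ m₀ := fun g hg => by
    have h1 : killBelow d d (φ g) = 0 := by
      simpa [q, Ideal.mem_comap, RingHom.mem_ker] using hg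
    rw [killBelow_top] at h1
    rw [RingHom.mem_ker, ← hcc g]
    exact C_eq_zero.1 h1
  -- heights in `Spec R̄`
  let pt : ℕ → PrimeSpectrum (MvPolynomial σ ℂ ⧸ P) := fun j =>
    ⟨(q j).map mk, hmapPrime (hqprime j) (hPq j)⟩
  let p0 : PrimeSpectrum (MvPolynomial σ ℂ ⧸ P) := ⟨⊥, Ideal.isPrime_bot⟩
  have hp0 : p0 < pt 0 := by
    rw [← PrimeSpectrum.asIdeal_lt_asIdeal]
    change (⊥ : Ideal (MvPolynomial σ ℂ ⧸ P)) < (q 0).map mk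
    refine bot_lt_iff_ne_bot.2 fun h => hy_out ?_
    have h1 := Ideal.mem_map_of_mem mk hy_in
    rw [h, Ideal.mem_bot] at h1
    exact Ideal.Quotient.eq_zero_iff_mem.1 h1
  have hpt : ∀ j, j < d → pt j < pt (j + 1) := fun j hj => by
    rw [← PrimeSpectrum.asIdeal_lt_asIdeal]
    exact hmap_lt (hPq j) (hqmono j (j + 1) (Nat.le_succ j)) _ (hx_in j hj) (hx_out j hj)
  have hheight : ∀ j, j ≤ d → ((j + 1 : ℕ) : ℕ∞) ≤ Order.height (pt j) := by
    intro j hj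
    induction j with
    | zero =>
      have h2 := Order.height_add_one_le hp0
      calc ((0 + 1 : ℕ) : ℕ∞) = 1 := by norm_num
        _ ≤ Order.height p0 + 1 := le_add_self
        _ ≤ Order.height (pt 0) := h2
    | succ j ih =>
      have h1 := ih (Nat.le_of_succ_le hj)
      have h2 := Order.height_add_one_le (hpt j (Nat.lt_of_succ_le hj))
      calc ((j + 1 + 1 : ℕ) : ℕ∞) = ((j + 1 : ℕ) : ℕ∞) + 1 := by push_cast; ring
        _ ≤ Order.height (pt j) + 1 := by gcongr
        _ ≤ Order.height (pt (j + 1)) := h2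
  let pM : PrimeSpectrum (MvPolynomial σ ℂ ⧸ P) := ⟨M₀, hM₀⟩
  have hle : pt d ≤ pM := by
    rw [← PrimeSpectrum.asIdeal_le_asIdeal]
    exact Ideal.map_mono hq_top
  have hMh : ((d + 1 : ℕ) : ℕ∞) ≤ M₀.height := by
    rw [Literature.RingTheory.KrullDimension.ideal_height_eq_orderHeight M₀]
    exact (hheight d le_rfl).trans (Order.height_mono hle)
  have hne : Qb ≠ M₀ := by
    intro h
    rw [h] at hQbh
    have h3 := ENat.coe_le_coe.1 (hMh.trans hQbh)
    omega
  -- pull the small prime back to `ℂ[x,y]` and apply the Nullstellensatz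
  let Q : Ideal (MvPolynomial σ ℂ) := Qb.comap mk
  haveI hQprime : Q.IsPrime := Ideal.comap_isPrime mk Qb
  have hQm : Q ≤ m₀ := by
    have h1 : Q ≤ M₀.comap mk := Ideal.comap_mono hQbM
    rwa [Ideal.comap_map_of_surjective mk hmk, ← RingHom.ker_eq_comap_bot, hker,
      sup_eq_left.mpr hPm] at h1
  have hQne : Q ≠ m₀ := fun h => hne <| by
    calc Qb = (Qb.comap mk).map mk := (Ideal.map_comap_of_surjective mk hmk Qb).symm
      _ = M₀ := by rw [show Qb.comap mk = m₀ from h]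
  have hBQ : ∀ i, Bp i ∈ Q := fun i =>
    Ideal.mem_comap.2 (by rw [Ideal.Quotient.eq_zero_iff_mem.2 (hBP i)]; exact Qb.zero_mem)
  have hLQ : ∀ q', Lp q' ∈ Q := fun q' =>
    Ideal.mem_comap.2 (hQb.1.2 (Ideal.subset_span
      (Finset.mem_coe.2 (Finset.mem_image.2 ⟨q', Finset.mem_univ _, rfl⟩))))
  have hnot : ¬ (zeroLocus ℂ Q ⊆ ({0} : Set (σ → ℂ))) := by
    intro hsub
    apply hQne (le_antisymm hQm ?_)
    have h1 : vanishingIdeal ℂ ({0} : Set (σ → ℂ)) ≤ vanishingIdeal ℂ (zeroLocus ℂ Q) :=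
      vanishingIdeal_anti_mono hsub
    rw [IsPrime.vanishingIdeal_zeroLocus] at h1
    refine le_trans (fun p hp => ?_) h1
    rw [mem_vanishingIdeal_iff]
    intro x hx
    rw [Set.mem_singleton_iff.1 hx, aeval_zero, Algebra.algebraMap_self_apply]
    exact (RingHom.mem_ker).1 hp
  obtain ⟨z, hzQ, hz0⟩ := Set.not_subset.1 hnot
  -- read off the isotropic vector
  have hzL : ∀ q', z (Sum.inr q') = z (Sum.inl q') := by
    intro q'
    have := (mem_zeroLocus_iff.1 hzQ) _ (hLQ q')
    simp only [Lp, map_sub, aeval_X] at this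
    exact sub_eq_zero.1 this
  have hzB : ∀ i, ∑ j, ∑ k, z (Sum.inl j) * M i j k * z (Sum.inr k) = 0 := by
    intro i
    have := (mem_zeroLocus_iff.1 hzQ) _ (hBQ i)
    simpa [Bp, map_sum, map_mul, aeval_X, aeval_C] using this
  refine ⟨fun j => z (Sum.inl j), ?_, fun i => ?_⟩
  · intro hx
    apply hz0
    funext v
    rcases v with j | q'
    · simpa using congr_fun hx j
    · rw [hzL]; simpa using congr_fun hx q'
  · have h := hzB i
    simp_rw [hzL] at h
    rw [dotProduct_mulVec_eq_sum]
    simp_rw [Finset.sum_mul]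
    rw [Finset.sum_comm]
    exact h

end Join

end Summit.MatrixMultiplication.MatrixMultiplication.Theorems.GraphEquations
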